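import Summits.Ventures.PercRepro.ProfileGapMonoTopButOne

/-!
# PercRepro — THE TOP-BUT-ONE LEVEL OF THE CO-RANK-`q` ROW ON THE MINIMAL GROUND SETS `#E = ρ(E) + q`, FROM THE
LOG-CONCAVITY OF THE BI-INDEPENDENT DENSITY (p10, gen 9; `proofs/P10-AVFULL.md` §18)

A set `X ⊆ E` is BI-INDEPENDENT when `X` and `E ∖ X` are both independent; `biIndepSets M k` is the set of
bi-independent `k`-sets and `P_k := #(biIndepSets M k)`.  Complementation gives `P_k = P_{n−k}`.

THE NAMED FACT `BiIndepDensityLogConcave` (a `Prop`, NOT asserted here): for every finite matroid the sequence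
`P_k / C(n,k)` is log-concave with no internal zeros.  Paper proof (P10-AVFULL.md §18(b)) from one published theorem:
the homogeneous independence polynomial `f_M(w₀; t) = Σ_{A ∈ I(M)} t^A w₀^{n−#A}` is Lorentzian
(Brändén–Huh, *Lorentzian polynomials*, Ann. of Math. (2) 192 (2020) 821–891, arXiv:1902.03719, proof of Thm 4.14 via
Thm 4.10; also Anari–Liu–Oveis Gharan–Vinzant, arXiv:1811.01600), together with the closure of the Lorentzian class under
products (BH Cor. 2.32), derivatives (BH Cor. 2.11) and nonnegative substitutions (BH Thm 2.10):
`Σ_k P_k s^{n−k} s'^k = ∂_{t₁}⋯∂_{tₙ}[f_M(s;t)·f_M(s';t)]|_{t=0}` is Lorentzian, and a bivariate Lorentzian polynomial has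
ultra-log-concave coefficients with no internal zeros (BH, proof of Thm 4.14).

THE THEOREM (`profileIneqMinusQ_top_but_one_of_card_eq`): under the named fact, `Π⁻_{q,ρ−1}` holds for every finite
matroid with `#E = ρ(E) + q` and `q + 2 ≤ ρ(E)` — the tight regime of the first open level of `HardRowQ''`, every `q`
(§17(c)'s «pair form»).  Proof: on `#E = ρ + q` the closed form `profileIneqMinusQ_top_but_one_iff` reads
`C(ρ,q+1)·P_q ≤ C(ρ−1,q)·P_{ρ−1}`, i.e. `ρ·P_ρ ≤ (q+1)·P_{ρ−1}` (`P_q = P_ρ`), i.e. `P_ρ/C(n,ρ) ≤ P_{ρ−1}/C(n,ρ−1)`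
(`ρ·C(n,ρ) = (q+1)·C(n,ρ−1)`), which is the unimodality of the symmetric log-concave density at `ρ − 1 ≥ n/2`.

* `biIndepSets`, `mem_biIndepSets`, `card_biIndepSets_symm`;
* `BiIndepDensityLogConcave` (the named fact), `lc_pairwise` (log-concave ⇒ pairwise inequality, over `ℚ`);
* `filter_Rq_eq_biIndepSets`, `filter_levelSetCoQ_eq_biIndepSets` (the two sides of the closed form on `#E = ρ + q`);
* **`profileIneqMinusQ_top_but_one_of_card_eq`**.
-/

open scoped Matroid

namespace PercRepro.Cogirth

open Finset ThmH Skew Shadow Profile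

variable {α : Type} [DecidableEq α] {M : Matroid α} [M.Finite]

/-! ### Bi-independent sets -/

/-- The bi-independent `k`-subsets of the ground set: `X` and `E ∖ X` both independent. -/
noncomputable def biIndepSets (M : Matroid α) [M.Finite] (k : ℕ) : Finset (Finset α) :=
  (gr M).powerset.filter (fun X => X.card = k ∧ rk M X = X.card ∧ rk M (gr M \ X) = (gr M \ X).card)

/-- Membership in `biIndepSets`. -/
theorem mem_biIndepSets {k : ℕ} {X : Finset α} :
    X ∈ biIndepSets M k ↔ X ⊆ gr M ∧ X.card = k ∧ rk M X = X.card ∧ rk M (gr M \ X) = (gr M \ X).card := by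
  unfold biIndepSets
  rw [mem_filter, mem_powerset]

/-- Complementation: `P_k = P_{n−k}`. -/
theorem card_biIndepSets_symm (M : Matroid α) [M.Finite] {k : ℕ} (hk : k ≤ (gr M).card) :
    (biIndepSets M k).card = (biIndepSets M ((gr M).card - k)).card := by
  apply card_bij (fun X _ => gr M \ X)
  · intro X hX
    rw [mem_biIndepSets] at hX ⊢
    obtain ⟨hXg, hXk, hXr, hXc⟩ := hX
    refine ⟨sdiff_subset, ?_, hXc, ?_⟩
    · rw [card_sdiff_of_subset hXg, hXk]
    · rw [Finset.sdiff_sdiff_eq_self hXg]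
      exact hXr
  · intro X₁ hX₁ X₂ hX₂ h
    have h₁ : X₁ ⊆ gr M := (mem_biIndepSets.1 hX₁).1
    have h₂ : X₂ ⊆ gr M := (mem_biIndepSets.1 hX₂).1
    rw [← Finset.sdiff_sdiff_eq_self h₁, ← Finset.sdiff_sdiff_eq_self h₂, h]
  · intro Y hY
    rw [mem_biIndepSets] at hY
    obtain ⟨hYg, hYk, hYr, hYc⟩ := hY
    refine ⟨gr M \ Y, ?_, Finset.sdiff_sdiff_eq_self hYg⟩
    rw [mem_biIndepSets]
    refine ⟨sdiff_subset, ?_, hYc, ?_⟩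
    · rw [card_sdiff_of_subset hYg, hYk]
      have := card_le_card hYg
      omega
    · rw [Finset.sdiff_sdiff_eq_self hYg]
      exact hYr

/-! ### The named fact -/

/-- **THE NAMED FACT** (a `Prop`; NOT asserted): for every finite matroid on `n` elements the bi-independent density
`P_k / C(n,k)` is log-concave — `P_{k−1} P_{k+1} C(n,k)² ≤ P_k² C(n,k−1) C(n,k+1)` — with no internal zeros.
Paper proof from Brändén–Huh (Lorentzian polynomials, Ann. of Math. 192 (2020); Thm 4.10 / proof of Thm 4.14,
Cor. 2.11, Cor. 2.32, Thm 2.10): P10-AVFULL.md §18(b). -/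
def BiIndepDensityLogConcave (α : Type) [DecidableEq α] : Prop :=
  ∀ (M : Matroid α) [M.Finite],
    (∀ k : ℕ, 1 ≤ k → k + 1 ≤ (gr M).card →
      (biIndepSets M (k - 1)).card * (biIndepSets M (k + 1)).card *
          ((gr M).card.choose k * (gr M).card.choose k) ≤
        (biIndepSets M k).card * (biIndepSets M k).card *
          ((gr M).card.choose (k - 1) * (gr M).card.choose (k + 1))) ∧
    (∀ i k j : ℕ, i < k → k < j → j ≤ (gr M).card →
      0 < (biIndepSets M i).card → 0 < (biIndepSets M j).card → 0 < (biIndepSets M k).card)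

/-! ### Log-concave sequences: the pairwise inequality -/

/-- A nonnegative log-concave sequence without internal zeros satisfies `a_{i−1} a_{j+1} ≤ a_i a_j` for `i ≤ j`
(induction on `j`). -/
theorem lc_pairwise {n : ℕ} (a : ℕ → ℚ) (ha : ∀ k, 0 ≤ a k)
    (hlc : ∀ k, 1 ≤ k → k + 1 ≤ n → a (k - 1) * a (k + 1) ≤ a k * a k)
    (hniz : ∀ i k j, i < k → k < j → j ≤ n → 0 < a i → 0 < a j → 0 < a k)
    (i : ℕ) (hi : 1 ≤ i) : ∀ j, i ≤ j → j + 1 ≤ n → a (i - 1) * a (j + 1) ≤ a i * a j := by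
  intro j
  induction j with
  | zero => intro hij _; omega
  | succ j ih =>
    intro hij hjn
    rcases Nat.eq_or_lt_of_le hij with h | h
    · subst h
      exact hlc (j + 1) (by omega) hjn
    have ih' := ih (by omega) (by omega)
    have hlc' := hlc (j + 1) (by omega) hjn
    -- a(j+1) * (a(i-1) * a(j+2)) ≤ a(j+1) * (a i * a(j+1))
    rcases (ha (j + 1)).lt_or_eq with hpos | hzero
    · have h1 : a (i - 1) * a (j + 1 + 1) * a (j + 1) ≤ a i * a j * a (j + 1 + 1) := by
        have := mul_le_mul_of_nonneg_right ih' (ha (j + 1 + 1))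
        linarith [this]
      have h2 : a i * a j * a (j + 1 + 1) ≤ a i * (a (j + 1) * a (j + 1)) := by
        have := mul_le_mul_of_nonneg_left hlc' (ha i)
        simpa [show j + 1 - 1 = j from by omega, mul_assoc] using this
      have h3 : a (j + 1) * (a (i - 1) * a (j + 1 + 1)) ≤ a (j + 1) * (a i * a (j + 1)) := by
        nlinarith [h1, h2]
      exact le_of_mul_le_mul_left h3 hpos
    · -- a (j+1) = 0: no internal zeros forces a (i-1) * a (j+2) = 0
      have hz : a (i - 1) * a (j + 1 + 1) = 0 := by
        by_contra hne
        have hi0 : 0 < a (i - 1) := lt_of_le_of_ne (ha _) (fun h0 => hne (by rw [← h0]; ring))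
        have hj0 : 0 < a (j + 1 + 1) := lt_of_le_of_ne (ha _) (fun h0 => hne (by rw [← h0]; ring))
        have := hniz (i - 1) (j + 1) (j + 1 + 1) (by omega) (by omega) hjn hi0 hj0
        rw [← hzero] at this
        exact lt_irrefl _ this
      rw [hz]
      exact mul_nonneg (ha i) (ha (j + 1))

/-! ### The two sides of the closed form on the minimal ground sets `#E = ρ + q` -/

omit [DecidableEq α] in
/-- `rk` from `eRk` in `Rq` / `levelSetCoQ` membership. -/
theorem rk_eq_of_eRk_eq {X : Finset α} {k : ℕ} (h : M.eRk (X : Set α) = (k : ℕ∞)) : rk M X = k := by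
  have := coe_rk (M := M) X
  rw [h] at this
  exact_mod_cast this

/-- On `#E = ρ + q`, the rank-`q` sets with spanning complement are exactly the bi-independent `q`-sets. -/
theorem filter_Rq_eq_biIndepSets {q : ℕ} (hn : (gr M).card = rk M (gr M) + q) :
    (Rq M q).filter (fun B => rk M (gr M \ B) = rk M (gr M)) = biIndepSets M q := by
  ext B
  rw [mem_filter, mem_Rq, mem_biIndepSets]
  constructor
  · rintro ⟨⟨hBg, hBr⟩, hBc⟩
    have hrk : rk M B = q := rk_eq_of_eRk_eq hBr
    have h1 := rk_le_card (M := M) B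
    have h2 := rk_le_card (M := M) (gr M \ B)
    have h3 := card_sdiff_of_subset hBg
    have h4 := card_le_card hBg
    refine ⟨hBg, by omega, by omega, by omega⟩
  · rintro ⟨hBg, hBk, hBr, hBc⟩
    have h3 := card_sdiff_of_subset hBg
    refine ⟨⟨hBg, ?_⟩, by omega⟩
    rw [← coe_rk, hBr, hBk]

/-- On `#E = ρ + q`, the rank-`(ρ−1)` sets of co-rank `≥ q + 1` are exactly the bi-independent `(ρ−1)`-sets. -/
theorem filter_levelSetCoQ_eq_biIndepSets {q : ℕ} (hn : (gr M).card = rk M (gr M) + q)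
    (hq : q + 1 ≤ rk M (gr M)) :
    (levelSetCoQ M q (rk M (gr M) - 1)).filter (fun S => q + 1 ≤ rk M (gr M \ S)) =
      biIndepSets M (rk M (gr M) - 1) := by
  ext S
  rw [mem_filter, mem_levelSetCoQ, mem_biIndepSets]
  constructor
  · rintro ⟨⟨⟨hSg, hSr⟩, _⟩, hSc⟩
    have hrk : rk M S = rk M (gr M) - 1 := rk_eq_of_eRk_eq hSr
    have h1 := rk_le_card (M := M) S
    have h2 := rk_le_card (M := M) (gr M \ S)
    have h3 := card_sdiff_of_subset hSg
    have h4 := card_le_card hSg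
    refine ⟨hSg, by omega, by omega, by omega⟩
  · rintro ⟨hSg, hSk, hSr, hSc⟩
    have h3 := card_sdiff_of_subset hSg
    have h4 := card_le_card hSg
    refine ⟨⟨⟨hSg, ?_⟩, by omega⟩, by omega⟩
    rw [← coe_rk, hSr, hSk]

/-! ### The theorem -/

/-- **`Π⁻_{q,ρ−1}` ON THE MINIMAL GROUND SETS `#E = ρ(E) + q`, FOR EVERY `q`**, from the named fact: the tight
regime of the first open level of `HardRowQ''` (§17(c)'s pair form).  `ρ·P_ρ ≤ (q+1)·P_{ρ−1}` is the monotonicity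
`P_ρ / C(n,ρ) ≤ P_{ρ−1} / C(n,ρ−1)` of the symmetric log-concave density at `ρ − 1 ≥ n/2`. -/
theorem profileIneqMinusQ_top_but_one_of_card_eq (hfact : BiIndepDensityLogConcave α) (M : Matroid α) [M.Finite]
    {q : ℕ} (hn : (gr M).card = rk M (gr M) + q) (hq : q + 2 ≤ rk M (gr M)) :
    ProfileIneqMinusQ M q (rk M (gr M) - 1) := by
  have hu : rk M (gr M) - 1 + 1 = rk M (gr M) := by omega
  rw [profileIneqMinusQ_top_but_one_iff (by omega) hu]
  have e1 : (Rq M q).filter (fun B => rk M (gr M \ B) = rk M (gr M) - 1 + 1) = biIndepSets M q := by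
    rw [hu]; exact filter_Rq_eq_biIndepSets hn
  rw [e1, filter_levelSetCoQ_eq_biIndepSets hn (by omega), hu]
  -- notation
  obtain ⟨hlc, hniz⟩ := hfact M
  generalize hρ : rk M (gr M) = ρ at *
  generalize hN : (gr M).card = n at *
  -- the densities
  set P : ℕ → ℕ := fun k => (biIndepSets M k).card with hP
  have hsymm : ∀ k, k ≤ n → P k = P (n - k) := by
    intro k hk
    simp only [hP]
    rw [← hN]
    exact card_biIndepSets_symm M (by omega)
  have hPq : P q = P ρ := by rw [hsymm q (by omega)]; congr 1; omega
  have hPq1 : P (q + 1) = P (ρ - 1) := by rw [hsymm (q + 1) (by omega)]; congr 1; omega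
  -- the pairwise inequality d_q d_ρ ≤ d_{q+1} d_{ρ-1} in ℚ
  let a : ℕ → ℚ := fun k => (P k : ℚ) / (n.choose k : ℚ)
  have ha : ∀ k, 0 ≤ a k := fun k => div_nonneg (Nat.cast_nonneg _) (Nat.cast_nonneg _)
  have hchoose_pos : ∀ k, k ≤ n → (0 : ℚ) < n.choose k := fun k hk => by exact_mod_cast Nat.choose_pos hk
  have halc : ∀ k, 1 ≤ k → k + 1 ≤ n → a (k - 1) * a (k + 1) ≤ a k * a k := by
    intro k hk1 hkn
    have h := hlc k hk1 hkn
    have c1 := hchoose_pos (k - 1) (by omega)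
    have c2 := hchoose_pos (k + 1) (by omega)
    have c3 := hchoose_pos k (by omega)
    simp only [a, hP]
    rw [div_mul_div_comm, div_mul_div_comm, div_le_div_iff₀ (by positivity) (by positivity)]
    have h' : ((biIndepSets M (k - 1)).card * (biIndepSets M (k + 1)).card *
        (n.choose k * n.choose k) : ℚ) ≤
        (biIndepSets M k).card * (biIndepSets M k).card * (n.choose (k - 1) * n.choose (k + 1)) := by
      exact_mod_cast h
    nlinarith [h']
  have haniz : ∀ i k j, i < k → k < j → j ≤ n → 0 < a i → 0 < a j → 0 < a k := by
    intro i k j hik hkj hjn hi hj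
    simp only [a, hP] at hi hj ⊢
    have ci := hchoose_pos i (by omega)
    have cj := hchoose_pos j (by omega)
    have ck := hchoose_pos k (by omega)
    rw [div_pos_iff_of_pos_right ci] at hi
    rw [div_pos_iff_of_pos_right cj] at hj
    rw [div_pos_iff_of_pos_right ck]
    exact_mod_cast hniz i k j hik hkj hjn (by exact_mod_cast hi) (by exact_mod_cast hj)
  have hpair := lc_pairwise (n := n) a ha halc haniz (q + 1) (by omega) (ρ - 1) (by omega) (by omega)
  -- d_{q+1} = d_{ρ-1} and d_q = d_ρ
  have hq1 : q + 1 - 1 = q := by omega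
  have hρ1 : ρ - 1 + 1 = ρ := by omega
  rw [hq1, hρ1] at hpair
  have hchoose_symm1 : n.choose (q + 1) = n.choose (ρ - 1) := by
    rw [← Nat.choose_symm (by omega : q + 1 ≤ n)]; congr 1; omega
  have hchoose_symm2 : n.choose q = n.choose ρ := by
    rw [← Nat.choose_symm (by omega : q ≤ n)]; congr 1; omega
  have ha1 : a (q + 1) = a (ρ - 1) := by simp only [a]; rw [hPq1, hchoose_symm1]
  have ha2 : a q = a ρ := by simp only [a]; rw [hPq, hchoose_symm2]
  rw [ha1, ha2] at hpair
  -- d_ρ ≤ d_{ρ-1}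
  have hdρ : a ρ ≤ a (ρ - 1) := by nlinarith [hpair, ha ρ, ha (ρ - 1)]
  -- back to ℕ: P_ρ * C(n,ρ-1) ≤ P_{ρ-1} * C(n,ρ)
  have hnat : P ρ * n.choose (ρ - 1) ≤ P (ρ - 1) * n.choose ρ := by
    have c1 := hchoose_pos ρ (by omega)
    have c2 := hchoose_pos (ρ - 1) (by omega)
    simp only [a] at hdρ
    rw [div_le_div_iff₀ c1 c2] at hdρ
    exact_mod_cast hdρ
  -- the binomial identities
  have hid1 : n.choose ρ * ρ = n.choose (ρ - 1) * (q + 1) := by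
    have := Nat.choose_succ_right_eq n (ρ - 1)
    rw [hρ1] at this
    rw [this]; congr 1; omega
  have hid2 : ρ * (ρ - 1).choose q = ρ.choose (q + 1) * (q + 1) := by
    have := Nat.add_one_mul_choose_eq (ρ - 1) q
    simpa [hρ1] using this
  -- conclude: C(ρ,q+1) * P_q ≤ C(ρ-1,q) * P_{ρ-1}
  show ρ.choose (q + 1) * P q ≤ (ρ - 1).choose q * P (ρ - 1)
  rw [hPq]
  have hpos : 0 < (q + 1) * n.choose (ρ - 1) := by
    have := Nat.choose_pos (show ρ - 1 ≤ n by omega); positivity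
  refine Nat.le_of_mul_le_mul_right ?_ hpos
  calc ρ.choose (q + 1) * P ρ * ((q + 1) * n.choose (ρ - 1))
      = (ρ.choose (q + 1) * (q + 1)) * (P ρ * n.choose (ρ - 1)) := by ring
    _ = (ρ * (ρ - 1).choose q) * (P ρ * n.choose (ρ - 1)) := by rw [hid2]
    _ ≤ (ρ * (ρ - 1).choose q) * (P (ρ - 1) * n.choose ρ) := Nat.mul_le_mul_left _ hnat
    _ = (ρ - 1).choose q * P (ρ - 1) * (n.choose ρ * ρ) := by ring
    _ = (ρ - 1).choose q * P (ρ - 1) * ((q + 1) * n.choose (ρ - 1)) := by rw [hid1]; ring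

end PercRepro.Cogirth
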